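import Summits.Ventures.CertifiedManyBodySolver.Rows.SourcedTorusRowsTwistedFlipHook
import HarnessLib

/-!
# PINNING-FIELD rows: FLIP-twisted (`D₄ × ℤ₂^{flip}`, sixteen operations) KKT one-point certificates inside a
# TWO-SIDED energy window

HONEST FRAMING: first certified bounds on pairing observables; not a superconductivity verdict; every
number certified (two lineages + referee) or labelled float. A response AT FIXED `h > 0` is
symmetry-allowed and says nothing about spontaneous order.

WHAT THIS FILE IS (cell hubbard-cq, D-0082 (c) / LADDER row PC-a, seat hubbard-cq-obsth-1 "pinning-field K5
menu nodes"; sequel of `Rows/SourcedTorusRowsTwistedFlipHook.lean` and the flip-twisted twin of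
`Rows/SourcedTorusRowsTwistedEnergyWindowHook.lean`). The tree theorem
`re_orbitState_ge_of_twistedFlip_sourced_window_certificate_TT'_kkt_of_energy_window`
(`Literature/…/DWaveSourceNNNHoppingTwistedFlipWindowCertificateKKT.lean`) reads ONE window identity for the one-point
objective `Γ(incl)(Φ₀ + Φ₀ᴴ)` with FLIP-TWISTED defects (all sixteen operations), a KKT block with
ARBITRARY generators and TWO energy terms `κ⁺ (u·1 − E^{src,tt'}) + κ⁻ (E^{src,tt'} − ℓ·1)` in the twisted orbit
flip-twisted orbit state of every `S^z`-eigenvector ground vector; with a q-slotted energy CEILING row at `u`, an energy FLOOR row at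
`ℓ` along `q' ∣ q` and a slot `r ≤ c − Σₖ ‖aₖ‖` it is a response FLOOR leaf
(`pinFieldResponseFloorAt_of_onePoint_twistedFlip_window_certificate_kkt_of_energyRows`).

NOTHING IS ASSERTED: identities and rows in, leaves out; no certificate, no number, no `sorry`, no named fact.
No definition. Elaborated under the torus files' local `DecidableEq (FermionTorus 2 L)` instance.

References: T. Koma, H. Tasaki, J. Stat. Phys. 76 (1994) 745, §1; J. Wang et al., PRX 14 (2024) 031006, §III;
M. Araújo et al., arXiv:2311.18707 §3.2 Prop. 11; O. Bratteli, D. W. Robinson II §5.2.2, §6.2.4.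
-/

noncomputable section

namespace Summit.Ventures.CertifiedManyBodySolver

open Literature.MathematicalPhysics.QuantumLattice
open Matrix HubbardWave0 Literature.Probability.LatticeModels Finset
open Literature.MathematicalPhysics.QuantumManyBody.StateRelaxation
open Summit.Ventures.CertifiedManyBodySolver.Observables
open scoped BigOperators ComplexOrder

/-- (Local to this file, as in `Rows/SourcedTorusRows[TwistedHook]`.) -/
local instance (priority := high) instDecidableEqFermionTorusSourcedTwFEWHook {L : ℕ} :
    DecidableEq (FermionTorus 2 L) :=
  LinearOrder.toDecidableEq

section EnergyWindow

/-- **Inside a TWO-SIDED energy window, flip-twisted defects: a KKT one-point certificate with the energy terms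
`κ⁺ (u·1 − E^{src,tt'}) + κ⁻ (E^{src,tt'} − ℓ·1)` (`κ⁺, κ⁻ ≥ 0`), the q-slotted CEILING row
`SourcedEnergyUpperRow tp U μ h q L₀ u` and a FLOOR row `SourcedEnergyLowerRow tp U μ h q' L₀' ℓ` with `q' ∣ q`
(`q' = 1`: a translation-invariant floor certificate) is a response FLOOR leaf** `∃ L₁, PinFieldResponseFloorAt tp U μ h q L₁ (r/2)`
for `r ≤ c − Σₖ ‖aₖ‖`. [cite: KomaTasaki1994, §1] [cite: WangEtAl2024, §III] -/
theorem pinFieldResponseFloorAt_of_onePoint_twistedFlip_window_certificate_kkt_of_energyRows (tp U μ h : ℝ)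
    {u ℓ r : ℚ} {q L₀ q' L₀' : ℕ} (hE : SourcedEnergyUpperRow tp U μ h q L₀ u)
    (hF : SourcedEnergyLowerRow tp U μ h q' L₀' ℓ) (hq : q' ∣ q)
    {Λ Λ' : Finset (Site 2)} (hΛ : Λ ⊆ Λ') (h8 : thicken Λ 1 ⊆ Λ')
    (h0 : thicken ({0} : Finset (Site 2)) 1 ⊆ Λ') (hz : (0 : Site 2) ∈ Λ')
    (hP : pairRegion (insert (0 : Site 2) unitSteps) 0 ⊆ Λ')
    {S : Finset (DihedralGroup 4)} (h1 : (1 : DihedralGroup 4) ∈ S) (hmul : ∀ a ∈ S, ∀ b ∈ S, a * b ∈ S)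
    {κp κm : ℝ} (hκp : 0 ≤ κp) (hκm : 0 ≤ κm)
    {m : Type*} [Fintype m] [DecidableEq m] {Λm : Matrix m m ℂ} (hΛm : Λm.PosSemidef)
    (O : m → FermionOp Λ')
    {κ' : Type*} (s : Finset κ') (B : κ' → FermionOp Λ)
    {ι : Type*} (tt : Finset ι) (γ : ι → DihedralGroup 4) (hγS : ∀ l ∈ tt, γ l ∈ S) (wv : ι → Site 2)
    (fl mt : ι → Fin 2) (hsh : ∀ l, d4ShiftSet (γ l) (wv l) Λ ⊆ Λ') (bb : ι → ℂ)
    (yw : ι → List (Orb (PolySite Λ) × Bool))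
    {ρ : Type*} (uu : Finset ρ) (b : ρ → ℂ) (cw : ρ → List (Orb (PolySite Λ') × Bool))
    (hcw : ∀ j ∈ uu, ladderSpinCharge (cw j) ≠ 0)
    {δ : Type*} (ah : Finset δ) (dc : δ → ℝ) (V : δ → FermionOp Λ')
    {κ'' : Type*} (w : Finset κ'') (a : κ'' → ℂ) (word : κ'' → List (Orb (PolySite Λ') × Bool))
    {β : Type*} [Fintype β] [DecidableEq β] {G : Matrix β β ℂ} (hG : G.PosSemidef)
    (Bk : β → FermionOp Λ) {c : ℝ}
    (hcert : fermionEmbed (PolySite.incl hP) onePointPairWord - (c : ℂ) • (1 : FermionOp Λ') -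
        ((κp : ℝ) : ℂ) • ((((u : ℚ) : ℝ) : ℂ) • (1 : FermionOp Λ') -
          (fermionEmbed (PolySite.incl h0) ((hubbardTTPrimeFermionInteraction 1 tp U).meanEnergyObs 1) -
            (μ : ℂ) • ∑ σ : Fin 2, nAt 0 hz σ -
            (h : ℂ) • (fermionEmbed (PolySite.incl hP) (localPairAt (insert (0 : Site 2) unitSteps) dWaveFormFactor 0) +
              (fermionEmbed (PolySite.incl hP) (localPairAt (insert (0 : Site 2) unitSteps) dWaveFormFactor 0))ᴴ))) -
        ((κm : ℝ) : ℂ) • ((fermionEmbed (PolySite.incl h0) ((hubbardTTPrimeFermionInteraction 1 tp U).meanEnergyObs 1) -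
            (μ : ℂ) • ∑ σ : Fin 2, nAt 0 hz σ -
            (h : ℂ) • (fermionEmbed (PolySite.incl hP) (localPairAt (insert (0 : Site 2) unitSteps) dWaveFormFactor 0) +
              (fermionEmbed (PolySite.incl hP) (localPairAt (insert (0 : Site 2) unitSteps) dWaveFormFactor 0))ᴴ)) -
          (((ℓ : ℚ) : ℝ) : ℂ) • (1 : FermionOp Λ')) =
      gramForm Λm O +
        (∑ k ∈ s, (pairSourceWindowHamiltonianTT' dWaveFormFactor Λ' tp U μ h * fermionEmbed (PolySite.incl hΛ) (B k) -
            fermionEmbed (PolySite.incl hΛ) (B k) * pairSourceWindowHamiltonianTT' dWaveFormFactor Λ' tp U μ h) +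
          ∑ l ∈ tt, bb l • (gaugePhase (twistFlipExp (γ l) (fl l) (mt l)) (yw l) •
              fermionEmbed (PolySite.incl (hsh l))
                (fermionEmbed (PolySite.d4Emb (γ l) (wv l) Λ) (spinSwapIter (fl l).val (ladderWord (yw l)))) -
            fermionEmbed (PolySite.incl hΛ) (ladderWord (yw l))) +
          ∑ j ∈ uu, b j • ladderWord (cw j)) +
        (∑ m' ∈ ah, ((dc m' : ℝ) : ℂ) • ((V m')ᴴ - V m') + ∑ k ∈ w, a k • ladderWord (word k)) +
        kktForm (pairSourceWindowHamiltonianTT' dWaveFormFactor Λ' tp U μ h) G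
          (fun b' => fermionEmbed (PolySite.incl hΛ) (Bk b')))
    (hr : ((r : ℚ) : ℝ) ≤ c - ∑ k ∈ w, ‖a k‖) :
    ∃ L₁ : ℕ, PinFieldResponseFloorAt tp U μ h q L₁ (r / 2) := by
  obtain ⟨L₂, hL₂⟩ := exists_forall_le_injOn_proj (thicken Λ' 1)
  have hrow : SourcedCorrLowerRowGS tp U μ h q (max (max 3 L₂) (max L₀ L₀')) r
      (pairRegion (insert (0 : Site 2) unitSteps) 0) ({1} : Finset (DihedralGroup 4)) onePointPairWord := by
    intro L _ hInjP hL hqL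
    have h3 : 3 ≤ L := le_trans (le_max_left _ _) (le_trans (le_max_left _ _) hL)
    have hInj : Set.InjOn (Torus.proj (d := 2) L) ↑(thicken Λ' 1) :=
      hL₂ L (le_trans (le_max_right _ _) (le_trans (le_max_left _ _) hL))
    have hInj' : Set.InjOn (Torus.proj (d := 2) L) ↑Λ' := hInj.mono (by exact_mod_cast subset_thicken Λ' 1)
    have hL0 : L₀ ≤ L := le_trans (le_max_left _ _) (le_trans (le_max_right _ _) hL)
    have hL0' : L₀' ≤ L := le_trans (le_max_right _ _) (le_trans (le_max_right _ _) hL)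
    have hLsq : (0 : ℝ) < (L : ℝ) ^ 2 := by
      have : (0 : ℝ) < (L : ℝ) := by exact_mod_cast Nat.pos_of_ne_zero (NeZero.ne L)
      positivity
    have hu : (dWaveSourceTorusTT' L tp U μ h).groundEnergy / (L : ℝ) ^ 2 ≤ ((u : ℚ) : ℝ) := by
      rw [div_le_iff₀ hLsq]
      exact hE L hL0 hqL
    have hℓ : ((ℓ : ℚ) : ℝ) ≤ (dWaveSourceTorusTT' L tp U μ h).groundEnergy / (L : ℝ) ^ 2 := by
      rw [le_div_iff₀ hLsq]
      exact hF L hL0' (dvd_trans hq hqL)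
    refine SourcedTorusCorrLowerRowGS.onePoint_of_twistedFlip_bound h1 hmul hP hInj' hInjP fun M ψ hψK hψ1 hgs => ?_
    exact hr.trans (re_orbitState_ge_of_twistedFlip_sourced_window_certificate_TT'_kkt_of_energy_window tp U μ h h3 hΛ h8
      h0 hz hP hInj hInj' h1 hmul hψK hψ1 hgs.2 _ hκp hκm hu hℓ hΛm O s B tt γ hγS wv fl mt hsh bb yw uu b cw hcw ah dc V
      w a word hG Bk hcert)
  exact ⟨max (max (max 3 L₂) (max L₀ L₀')) 3, hrow.pinFieldResponseFloorAt⟩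


end EnergyWindow

end Summit.Ventures.CertifiedManyBodySolver

end
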